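import HarnessLib
import Summits.Langlands.Langlands.Theses.DyadicOddResidue
import Literature.NumberTheory.GaloisRepresentations.ProjectiveTypeSolvable
import Literature.NumberTheory.GaloisRepresentations.AbsIrreducibleIndexTwo

/-!
# `DyadicNonsolvableFM` (stmt-Langlands-18744) — Negative knowledge: the residual hypotheses
# `IsResiduallyAbsIrreducible` and `IsIrreducible` are redundant

Crux-disprover lemma (cdisprove, route `DyadicOddResidue`, 2026-08-17) for the crux
`DyadicNonsolvableFM` — Fontaine–Mazur modularity over `ℚ` at `ℓ = 2` for `ρ : Γ_ℚ → GL₂(ℚ̄₂)`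
residually absolutely irreducible with NON-solvable residual image, irreducible, odd, a.e.
unramified, de Rham at `2` with distinct labelled Hodge–Tate weights (a theorem in print:
S.-N. Tung, Math. Z. 298 (2021), Thm. 1 = arXiv:1908.06174 p. 4, with Khare–Wintenberger 2009;
no `¬`-theorem of the crux is expected).  Hypothesis mutation made kernel-checked:

* `isAbsIrreducible_of_not_isSolvable_range` — **a homomorphism `σ : G → GL₂(k)` with
  non-solvable image is absolutely irreducible** (any field `k`, any characteristic): a
  reducible two-dimensional representation stabilises a line, the stabiliser of a line in `GL₂`
  is conjugate to the Borel subgroup, and the Borel subgroup is solvable (diagonal character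
  `B → kˣ × kˣ` with commutative unipotent kernel) — `isSolvable_eigenvectorStabilizer`,
  `isSolvable_range_of_not_isIrreducible`; extension of scalars does not change the image
  (`GL₂(f)` is injective).
* `isResiduallyAbsIrreducible_of_not_isSolvable_residualRep_range` — for
  `ρ : Γ_K → GL₂(ℚ̄_ℓ)`: **`¬ IsSolvable ρ.residualRep.range → ρ.IsResiduallyAbsIrreducible`**
  (the chosen residual representation is a semisimplification of a reduction `τ₀` with
  `ker τ₀ ≤ ker ρ̄`, so `τ₀` has non-solvable image; the junk branch `residualRep = 1` has
  trivial image and is excluded by the hypothesis itself).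
* `isIrreducible_of_not_isSolvable_residualRep_range` — **… `→ ρ.toGaloisRep.IsIrreducible`**
  (through the tree's Burnside form `IsResiduallyAbsIrreducible.isAbsolutelyIrreducible`,
  Darmon–Diamond–Taylor §2.1).
* `dyadicNonsolvableFM_minimal` — consequently the crux implies (hence is equivalent to: the
  converse is a weakening) its MINIMAL form with the two hypotheses
  `ρ.IsResiduallyAbsIrreducible`, `ρ.toGaloisRep.IsIrreducible` deleted and `ℓ := 2`
  substituted.  Finding for planners/provers: these two binders of items 18741/18742/18744 carry
  no information once `¬ IsSolvable ρ.residualRep.range` (resp. its dihedral analogue) is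
  assumed; a cite-fact `Tung2020_fontaineMazurGL2_two` needs neither.

No statement of the route is asserted; the crux appears only as a HYPOTHESIS. [folklore]
-/

set_option linter.dupNamespace false -- project-wide option (lakefile weak.linter.dupNamespace); `Summit.Langlands.Langlands` is the mandated namespace

noncomputable section

open scoped MatrixGroups
open Matrix NumberField IsDedekindDomain Filter
open Literature.NumberTheory.GaloisRepresentations Literature.NumberTheory.Automorphic

namespace Summit.Langlands.Langlands.Theorems.DyadicNonsolvableFM.Negative

variable {G : Type*} [Group G] {k : Type*} [Field k]

/-- A two-dimensional representation which is not irreducible has a common eigenvector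
(a non-zero vector spanning a `G`-stable line). [folklore] -/
theorem hasCommonEigenvector_of_not_isIrreducible (σ : G →* GL (Fin 2) k)
    (h : ¬ (toStdRepresentation σ).IsIrreducible) : HasCommonEigenvector σ := by
  classical
  have hbt : (⊥ : Subrepresentation (toStdRepresentation σ)) ≠ ⊤ := by
    intro hbt
    have hmem :
        (Pi.single 0 1 : Fin 2 → k) ∈ (⊤ : Subrepresentation (toStdRepresentation σ)) := by
      change (Pi.single 0 1 : Fin 2 → k) ∈ (⊤ : Submodule k (Fin 2 → k))
      exact Submodule.mem_top
    rw [← hbt] at hmem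
    change (Pi.single 0 1 : Fin 2 → k) ∈ (⊥ : Submodule k (Fin 2 → k)) at hmem
    have h0 : (Pi.single (0 : Fin 2) (1 : k) : Fin 2 → k) = 0 := by
      rwa [Submodule.mem_bot] at hmem
    simpa using congr_fun h0 0
  obtain ⟨W, hWb, hWt⟩ :
      ∃ W : Subrepresentation (toStdRepresentation σ), W ≠ ⊥ ∧ W ≠ ⊤ := by
    by_contra hall
    push Not at hall
    haveI : Nontrivial (Subrepresentation (toStdRepresentation σ)) := ⟨⟨⊥, ⊤, hbt⟩⟩
    exact h ⟨fun W => or_iff_not_imp_left.mpr (hall W)⟩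
  have hWb' : W.toSubmodule ≠ ⊥ := fun h' =>
    hWb (Subrepresentation.toSubmodule_injective (h'.trans rfl))
  have hWt' : W.toSubmodule ≠ ⊤ := fun h' =>
    hWt (Subrepresentation.toSubmodule_injective (h'.trans rfl))
  obtain ⟨v, hvW, hv0⟩ := (Submodule.ne_bot_iff _).mp hWb'
  have hdimW : Module.finrank k W.toSubmodule = 1 := by
    have hlt : Module.finrank k W.toSubmodule < 2 :=
      (Submodule.finrank_lt hWt').trans_eq (Module.finrank_fin_fun k)
    have hpos : 0 < Module.finrank k W.toSubmodule := by
      rw [pos_iff_ne_zero, Ne, Submodule.finrank_eq_zero]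
      exact hWb'
    omega
  have hspan : (k ∙ v) = W.toSubmodule :=
    Submodule.eq_of_le_of_finrank_eq ((Submodule.span_singleton_le_iff_mem v _).mpr hvW)
      (by rw [finrank_span_singleton hv0, hdimW])
  refine ⟨v, hv0, fun g => ?_⟩
  have hmem : ((σ g : GL (Fin 2) k) : Matrix (Fin 2) (Fin 2) k) *ᵥ v ∈ (k ∙ v) := by
    rw [hspan]
    exact W.apply_mem_toSubmodule g hvW
  obtain ⟨a, ha⟩ := Submodule.mem_span_singleton.mp hmem
  exact ⟨a, ha.symm⟩

/-- Membership in the stabiliser of the first coordinate line: the `(1,0)` entry vanishes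
(upper-triangular matrices). [folklore] -/
theorem mem_eigenvectorStabilizer_single_iff (M : GL (Fin 2) k) :
    M ∈ eigenvectorStabilizer (Pi.single 0 1 : Fin 2 → k) (by simp) ↔
      (M : Matrix (Fin 2) (Fin 2) k) 1 0 = 0 := by
  rw [mem_eigenvectorStabilizer_iff]
  constructor
  · rintro ⟨a, ha⟩
    have h1 := congr_fun ha 1
    rw [Matrix.mulVec_single_one] at h1
    simpa using h1
  · intro h10
    refine ⟨(M : Matrix (Fin 2) (Fin 2) k) 0 0, ?_⟩
    rw [Matrix.mulVec_single_one]
    ext i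
    fin_cases i <;> simp [h10]

/-- **The Borel subgroup of `GL₂(k)` is solvable**: the stabiliser of the first coordinate line
(upper-triangular matrices) is an extension of the abelian group `kˣ × kˣ` (diagonal entries) by
the abelian group of unipotent upper-triangular matrices. [folklore] -/
theorem isSolvable_eigenvectorStabilizer_single :
    IsSolvable (eigenvectorStabilizer (Pi.single 0 1 : Fin 2 → k) (by simp)) := by
  set B := eigenvectorStabilizer (Pi.single 0 1 : Fin 2 → k) (by simp) with hB
  have h10 : ∀ M : B, ((M : GL (Fin 2) k) : Matrix (Fin 2) (Fin 2) k) 1 0 = 0 := fun M =>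
    (mem_eigenvectorStabilizer_single_iff (M : GL (Fin 2) k)).mp M.2
  have hdiag : ∀ M : B,
      ((M : GL (Fin 2) k) : Matrix (Fin 2) (Fin 2) k) 0 0 ≠ 0 ∧
        ((M : GL (Fin 2) k) : Matrix (Fin 2) (Fin 2) k) 1 1 ≠ 0 := by
    intro M
    have hdet := GL2.det_ne_zero (M : GL (Fin 2) k)
    rw [Matrix.det_fin_two, h10 M, mul_zero, sub_zero] at hdet
    exact ⟨left_ne_zero_of_mul hdet, right_ne_zero_of_mul hdet⟩
  -- the diagonal character `B → kˣ × kˣ`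
  let χ : B →* kˣ × kˣ := MonoidHom.mk'
    (fun M => (Units.mk0 _ (hdiag M).1, Units.mk0 _ (hdiag M).2))
    (by
      intro M N
      ext
      · simp [Matrix.mul_apply, Fin.sum_univ_two, h10 N]
      · simp [Matrix.mul_apply, Fin.sum_univ_two, h10 M])
  have hχ1 : ∀ M : B, ((χ M).1 : k) = ((M : GL (Fin 2) k) : Matrix (Fin 2) (Fin 2) k) 0 0 :=
    fun M => rfl
  have hχ2 : ∀ M : B, ((χ M).2 : k) = ((M : GL (Fin 2) k) : Matrix (Fin 2) (Fin 2) k) 1 1 :=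
    fun M => rfl
  -- its kernel (unipotent upper-triangular matrices) is commutative
  haveI : IsSolvable χ.ker := by
    refine isSolvable_of_comm fun a b => ?_
    obtain ⟨a, hak⟩ := a
    obtain ⟨b, hbk⟩ := b
    rw [MonoidHom.mem_ker, Prod.ext_iff] at hak hbk
    have ha0 : ((a : GL (Fin 2) k) : Matrix (Fin 2) (Fin 2) k) 0 0 = 1 := by
      rw [← hχ1, hak.1]; rfl
    have ha1 : ((a : GL (Fin 2) k) : Matrix (Fin 2) (Fin 2) k) 1 1 = 1 := by
      rw [← hχ2, hak.2]; rfl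
    have hb0 : ((b : GL (Fin 2) k) : Matrix (Fin 2) (Fin 2) k) 0 0 = 1 := by
      rw [← hχ1, hbk.1]; rfl
    have hb1 : ((b : GL (Fin 2) k) : Matrix (Fin 2) (Fin 2) k) 1 1 = 1 := by
      rw [← hχ2, hbk.2]; rfl
    have ha10 := h10 a
    have hb10 := h10 b
    refine Subtype.ext (Subtype.ext (Units.ext ?_))
    change ((a : GL (Fin 2) k) : Matrix (Fin 2) (Fin 2) k) *
        ((b : GL (Fin 2) k) : Matrix (Fin 2) (Fin 2) k) =
      ((b : GL (Fin 2) k) : Matrix (Fin 2) (Fin 2) k) *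
        ((a : GL (Fin 2) k) : Matrix (Fin 2) (Fin 2) k)
    ext i j
    fin_cases i <;> fin_cases j <;>
      simp [Matrix.mul_apply, Fin.sum_univ_two, ha0, ha1, hb0, hb1, ha10, hb10, add_comm]
  exact solvable_of_ker_le_range χ.ker.subtype χ (by rw [Subgroup.range_subtype])

/-- **The stabiliser in `GL₂(k)` of any line is solvable**: it is conjugate to the Borel
subgroup (complete the vector to an invertible matrix). [folklore] -/
theorem isSolvable_eigenvectorStabilizer (v : Fin 2 → k) (hv : v ≠ 0) :
    IsSolvable (eigenvectorStabilizer v hv) := by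
  classical
  obtain ⟨w, hdet⟩ : ∃ w : Fin 2 → k, v 0 * w 1 - w 0 * v 1 ≠ 0 := by
    by_cases h0 : v 0 = 0
    · refine ⟨![1, 0], ?_⟩
      have h1 : v 1 ≠ 0 := by
        intro h1
        apply hv
        ext i
        fin_cases i <;> simp [h0, h1]
      simpa [h0] using h1
    · exact ⟨![0, 1], by simpa using h0⟩
  let Pm : Matrix (Fin 2) (Fin 2) k := !![v 0, w 0; v 1, w 1]
  have hPdet : Pm.det ≠ 0 := by
    rw [Matrix.det_fin_two_of]
    exact hdet
  let P : GL (Fin 2) k := Matrix.GeneralLinearGroup.mkOfDetNeZero Pm hPdet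
  have hPv : (P : Matrix (Fin 2) (Fin 2) k) *ᵥ Pi.single 0 1 = v := by
    rw [Matrix.mulVec_single_one]
    ext i
    fin_cases i <;> rfl
  have key : ∀ h ∈ eigenvectorStabilizer v hv,
      P⁻¹ * h * P ∈ eigenvectorStabilizer (Pi.single 0 1 : Fin 2 → k) (by simp) := by
    intro h hh
    obtain ⟨a, ha⟩ := hh
    refine ⟨a, ?_⟩
    rw [Matrix.GeneralLinearGroup.coe_mul, Matrix.GeneralLinearGroup.coe_mul,
      ← Matrix.mulVec_mulVec, ← Matrix.mulVec_mulVec, hPv, ha, Matrix.mulVec_smul, ← hPv,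
      Matrix.mulVec_mulVec, ← Matrix.GeneralLinearGroup.coe_mul, inv_mul_cancel,
      Matrix.GeneralLinearGroup.coe_one, Matrix.one_mulVec]
  let φ : eigenvectorStabilizer v hv →*
      eigenvectorStabilizer (Pi.single 0 1 : Fin 2 → k) (by simp) :=
    { toFun := fun h => ⟨P⁻¹ * h * P, key h h.2⟩
      map_one' := Subtype.ext (by simp)
      map_mul' := fun a b => Subtype.ext (by
        simp only [Subgroup.coe_mul]
        group) }
  have hφ : Function.Injective φ := by
    intro a b hab
    have h' : P⁻¹ * (a : GL (Fin 2) k) * P = P⁻¹ * (b : GL (Fin 2) k) * P :=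
      congrArg Subtype.val hab
    exact Subtype.ext (mul_left_cancel (mul_right_cancel h'))
  haveI := isSolvable_eigenvectorStabilizer_single (k := k)
  exact solvable_of_solvable_injective hφ

/-- **A two-dimensional representation which is not irreducible has solvable image**: the image
stabilises a line, and the stabiliser of a line in `GL₂` is solvable. [folklore] -/
theorem isSolvable_range_of_not_isIrreducible (σ : G →* GL (Fin 2) k)
    (h : ¬ (toStdRepresentation σ).IsIrreducible) : IsSolvable σ.range := by
  obtain ⟨v, hv, key⟩ := hasCommonEigenvector_of_not_isIrreducible σ h
  have hle : σ.range ≤ eigenvectorStabilizer v hv := by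
    rintro _ ⟨g, rfl⟩
    exact key g
  haveI := isSolvable_eigenvectorStabilizer v hv
  exact solvable_of_solvable_injective (Subgroup.inclusion_injective hle)

/-- `GL₂(f)` is injective for a field homomorphism `f`. [folklore] -/
theorem generalLinearGroup_map_injective {k' : Type*} [Field k'] (f : k →+* k') :
    Function.Injective (Matrix.GeneralLinearGroup.map (n := Fin 2) f) := by
  intro a b hab
  ext i j
  apply f.injective
  have := congrArg (fun M : GL (Fin 2) k' => (M : Matrix (Fin 2) (Fin 2) k') i j) hab
  simpa [Matrix.GeneralLinearGroup.map_apply] using this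

/-- **Non-solvable image forces absolute irreducibility** (rank `2`, any field, any
characteristic): after any extension of scalars `f : k → k'` the image is isomorphic to the
original one (`GL₂(f)` is injective), and a reducible two-dimensional representation has
solvable image (`isSolvable_range_of_not_isIrreducible`). [folklore] -/
theorem isAbsIrreducible_of_not_isSolvable_range (σ : G →* GL (Fin 2) k)
    (h : ¬ IsSolvable σ.range) : IsAbsIrreducible σ := by
  intro k' _ f
  by_contra hirr
  apply h
  have hs : IsSolvable ((Matrix.GeneralLinearGroup.map f).comp σ).range :=
    isSolvable_range_of_not_isIrreducible _ hirr
  rw [MonoidHom.range_comp] at hs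
  exact solvable_of_solvable_injective
    (f := (σ.range.equivMapOfInjective _ (generalLinearGroup_map_injective f)).toMonoidHom)
    (σ.range.equivMapOfInjective _ (generalLinearGroup_map_injective f)).injective

/-- Solvability of the image passes along `ker τ₀ ≤ ker τ` (the image of `τ` is a quotient of the
image of `τ₀`). [folklore] -/
theorem isSolvable_range_of_ker_le {N N' : Type*} [Group N] [Group N'] {τ₀ : G →* N}
    {τ : G →* N'} (hker : τ₀.ker ≤ τ.ker) (h : IsSolvable τ₀.range) : IsSolvable τ.range := by
  haveI : IsSolvable (G ⧸ τ₀.ker) :=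
    solvable_of_surjective (f := (QuotientGroup.quotientKerEquivRange τ₀).symm.toMonoidHom)
      (MulEquiv.surjective _)
  have hle : τ₀.ker ≤ τ.ker.comap (MonoidHom.id G) := by simpa using hker
  haveI : IsSolvable (G ⧸ τ.ker) := by
    refine solvable_of_surjective (f := QuotientGroup.map τ₀.ker τ.ker (MonoidHom.id G) hle) ?_
    exact QuotientGroup.map_surjective_of_surjective τ₀.ker τ.ker (MonoidHom.id G)
      (fun x => by
        obtain ⟨g, rfl⟩ := QuotientGroup.mk_surjective x
        exact ⟨g, rfl⟩) hle
  exact solvable_of_surjective (f := (QuotientGroup.quotientKerEquivRange τ).toMonoidHom)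
    (MulEquiv.surjective _)

/-- **Hypothesis `hres` of the crux follows from hypothesis `hsol`**: for
`ρ : Γ_K → GL₂(ℚ̄_ℓ)`, if the image of the (semisimplified) residual representation
`ρ.residualRep` is not solvable then `ρ` is residually absolutely irreducible.  (The junk branch
of `residualRep` has trivial, hence solvable, image; otherwise `residualRep` is a
semisimplification of a reduction `τ₀`, `ker τ₀ ≤ ker residualRep`, so `τ₀` has non-solvable
image and is absolutely irreducible by `isAbsIrreducible_of_not_isSolvable_range`.) [folklore] -/
theorem isResiduallyAbsIrreducible_of_not_isSolvable_residualRep_range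
    {K : Type*} [Field K] {ℓ : ℕ} [Fact ℓ.Prime] (ρ : FramedGaloisRep K (PadicAlgCl ℓ) 2)
    (h : ¬ IsSolvable ρ.residualRep.range) : ρ.IsResiduallyAbsIrreducible := by
  classical
  have hex : ∃ τ, ρ.IsResidualRepOf (RingHom.id _) τ := by
    by_contra hne
    apply h
    rw [FramedGaloisRep.residualRep, dif_neg hne, MonoidHom.range_one]
    infer_instance
  obtain ⟨τ₀, hred, hss⟩ := FramedGaloisRep.residualRep_spec ρ hex
  refine ⟨τ₀, hred, isAbsIrreducible_of_not_isSolvable_range τ₀ fun hsol => h ?_⟩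
  exact isSolvable_range_of_ker_le hss.2.2 hsol

/-- **Hypothesis `hirr` of the crux follows from hypothesis `hres`**: a residually absolutely
irreducible `ρ : Γ_K → GL₂(ℚ̄_ℓ)` is irreducible (in-tree: Burnside form of residual absolute
irreducibility, `IsResiduallyAbsIrreducible.isAbsolutelyIrreducible`, Darmon–Diamond–Taylor §2.1).
[folklore] -/
theorem isIrreducible_of_isResiduallyAbsIrreducible
    {K : Type*} [Field K] {ℓ : ℕ} [Fact ℓ.Prime] (ρ : FramedGaloisRep K (PadicAlgCl ℓ) 2)
    (h : ρ.IsResiduallyAbsIrreducible) : ρ.toGaloisRep.IsIrreducible :=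
  (FramedGaloisRep.IsResiduallyAbsIrreducible.isAbsolutelyIrreducible two_pos h).isIrreducible

/-- … hence **`hsol` alone implies both `hres` and `hirr`**. [folklore] -/
theorem isIrreducible_of_not_isSolvable_residualRep_range
    {K : Type*} [Field K] {ℓ : ℕ} [Fact ℓ.Prime] (ρ : FramedGaloisRep K (PadicAlgCl ℓ) 2)
    (h : ¬ IsSolvable ρ.residualRep.range) : ρ.toGaloisRep.IsIrreducible :=
  isIrreducible_of_isResiduallyAbsIrreducible ρ
    (isResiduallyAbsIrreducible_of_not_isSolvable_residualRep_range ρ h)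


/-! ### The crux implies its minimal form -/

/-- **`DyadicNonsolvableFM` implies its minimal five-hypothesis form** (non-solvable residual
image, odd, a.e. unramified, de Rham at `2` with distinct labelled Hodge–Tate weights ⟹
automorphic a.e.): the binders `ρ.IsResiduallyAbsIrreducible` and `ρ.toGaloisRep.IsIrreducible`
of the route decl are supplied by `isResiduallyAbsIrreducible_of_not_isSolvable_residualRep_range`
and `isIrreducible_of_not_isSolvable_residualRep_range`, and `ℓ := 2` is substituted.  (The
converse implication is the trivial weakening, so this is an equivalence; only this direction
is recorded on the negative lane.) [folklore] -/
theorem dyadicNonsolvableFM_minimal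
    (h : Summit.Langlands.Langlands.Theses.DyadicOddResidue.DyadicNonsolvableFM)
    (ρ : FramedGaloisRep ℚ (PadicAlgCl 2) 2) (hsol : ¬ IsSolvable ρ.residualRep.range)
    (hodd : ρ.IsOdd)
    (hunr : ∀ᶠ v : HeightOneSpectrum (𝓞 ℚ) in cofinite, ρ.IsUnramifiedAt v)
    (hdR : ∀ (v : HeightOneSpectrum (𝓞 ℚ)) (hv : ((2 : ℕ) : 𝓞 ℚ) ∈ v.asIdeal),
      (Literature.NumberTheory.PAdicHodge.fontainePstAdicCompletion v 2 hv).IsDeRhamFramed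
          (ρ.toLocal v) ∧
        ∀ τ : v.adicCompletion ℚ →+* PadicAlgCl 2, Continuous τ →
          (ρ.labelledHodgeTateWeightsAt v
            (Literature.NumberTheory.PAdicHodge.fontainePstAdicCompletion v 2 hv).algebra
            (Literature.NumberTheory.PAdicHodge.fontainePstAdicCompletion v 2 hv).𝔅 τ).Nodup)
    (hcpt : isCompact_glFiniteIntegralLevel 2 ℚ) (ι : PadicAlgCl 2 ≃+* ℂ) :
    ∃ π : CuspidalAutomorphicRepData 2 ℚ hcpt, π.1.IsLAlgebraic ∧
      ∀ᶠ v : HeightOneSpectrum (𝓞 ℚ) in cofinite,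
        Summit.Langlands.SatakeFrobCompatibleAt ι π.1 ρ v :=
  h 2 rfl ρ (isResiduallyAbsIrreducible_of_not_isSolvable_residualRep_range ρ hsol) hsol
    (isIrreducible_of_not_isSolvable_residualRep_range ρ hsol) hodd hunr hdR hcpt ι

end Summit.Langlands.Langlands.Theorems.DyadicNonsolvableFM.Negative

end
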